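import Mathlib
import HarnessLib
import Summits.HubbardSuperconductivity.HubbardSuperconductivity.Theorems.KLProgrammeKLRegimeEngineLastStepResponseBracketFlowSharpAlias

/-!
# K3 gen-8-FLOW (stmt 20437, stub (C), located item #20, cure (δ′) «LAST-STEP SWAP», layer F3i): THE FINAL FORM OF THE #20 (δ′) DOOR —
# `lastResponse_bracket_flow_final`: moment Bell rows folded, `Zt` instantiated

Cell gate-hubbard-kl, seat p2 g20 («(δ′)-ALIAS-ROWS», step 5 = cosmetic completion).  On top of `lastResponse_bracket_flow_sharp_alias` (p636280) the ten
moment Bell rows `hPP_b0..4`, `hPP_c0..4` and the two size rows `hPP_bs`, `hPP_cs` are discharged by the graded Bell lemma (`PP_X j := Nm_X·P₄·lʲ` from the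
graded envelopes `Mm_X j ≤ Nm_X·lʲ`), leaving TWO scalar size rows `hZb : Nm_b·P₄ ≤ Zb·U`, `hZc : Nm_c·P₄·4^{n_β} ≤ Zc·U²`; and `Zt := 128·(ΣGfr)·P₄` is written
into the two smallness rows.  WHAT THE DOOR NOW READS (complete list): the regime (`hR … hK`), the engine history and closed envelopes
(`hGS hQS hR0 hPh hT hW hΞ hΘ hdoor`), the registered volume door `hL : klEngL₄ P R β U ≤ L`, the analyticity input `hZn`, the two smallness rows `hZtU`, `hCU`
(explicit in `R, Zb, Zc, Nm_X, Ns_X`), `hs : 10 ≤ s`, the four moment data `hMm_b hMs_b hMm_c hMs_c` with their graded envelopes `hNm_X hNs_X` and the two size rows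
`hZb hZc`.  Output unchanged: `(hRdiff, hR)` of `twoLegReadPriv_flow_succ_of_swap_lit` at `n = n_β`.

* **`lastResponse_bracket_flow_final`**.

Composition only; no definitions; nothing asserts superconductivity.  Refs: BGM 2006 §2.2 (2.23), §2.3 (2.21)–(2.24), §2.4 Lemma 2.1 (2.36)–(2.42), §3 (3.2)
[cite: BenfattoGiulianiMastropietro2006]; FST 1996 §1 [cite: FeldmanSalmhoferTrubowitz1996].
-/

noncomputable section

namespace Summit.HubbardSuperconductivity.HubbardSuperconductivity.Theorems.EngineV8

set_option linter.dupNamespace false -- summit = problem name (single-conjunct summit), D-0017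

open Complex Real Finset Filter Literature.MathematicalPhysics.QuantumLattice Literature.Probability.LatticeModels
open Literature.MathematicalPhysics.QuantumLattice.BandSectorCounting
open Literature.Analysis.Fourier Literature.Analysis.Calculus
open Summit.HubbardSuperconductivity.HubbardSuperconductivity.Theorems.KLRegimeSplit
open Summit.HubbardSuperconductivity.HubbardSuperconductivity.Theorems.DispersionFlow
open Summit.HubbardSuperconductivity.HubbardSuperconductivity.Theorems.KLProgrammeLegKernels
open Summit.HubbardSuperconductivity.HubbardSuperconductivity.Theorems.PerturbedFermiCurve
open scoped Nat

section FlowFinal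

variable {L M : ℕ} [NeZero L] [NeZero M]

/-- **THE #20 (δ′) DOOR, FINAL FORM** — see the module docstring.  Output = `(hRdiff, hR)` of `twoLegReadPriv_flow_succ_of_swap_lit` at `n = nScales β`
with `eR = fun k => if k = 0 then 0 else 1`, `eR' = fun k => if k = 0 then 1 else 0`. -/
theorem lastResponse_bracket_flow_final {R : RenConsts} (hR : ∀ j, 0 ≤ R.Gfr j) {c : ℝ} (hc : 0 < c) (hcle : c ≤ klCurveC3 R)
    {U : ℝ} (hU : 0 < U) (hU1 : U ≤ 1) (hUle : U ≤ klCurveU0 R) {β : ℝ} (hβmin : klBetaMin ≤ β) (hβc : β ≤ Real.exp (c / U ^ 2))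
    {μ : ℝ} (hμ : μ ∈ klWindowC) (hK : FrameOK R U (nScales β) μ (klFlowFrameU L M β U μ (nScales β))) {G : GeoConsts} {Q : EngConsts} (hGS : ∀ k, 0 ≤ G.S k) (hQS : ∀ k, 0 ≤ Q.S' k) (hR0 : 0 < R.Gfr 0)
    (hPh : ∀ m ≤ nScales β, FlowPieceJetsAt L M β U μ R m) (hT : ∀ m ≤ nScales β, TwoLegReadJetsF L M G Q β U μ m) {W Ξ Θ : ℝ}
    (hW : W = curveExtC (klChi2CauchyTab2 4) G.S 1 + curveExtC (klChi2CauchyTab2 4) Q.S' 1 * |U|) (hΞ : Ξ = 2 ^ 10 * (1 + Real.pi ^ 8 * (W * U ^ 2) / 2 ^ 11) + ∑ j ∈ range 5, R.Gfr j)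
    (hΘ : Θ = 1 + ((∑ j ∈ range 5, R.Gfr j) + Real.pi ^ 8 * W / 2 ^ 11) * |U| / R.Gfr 0)
    (hdoor : R.Gfr 0 * |U| + ((∑ j ∈ range 5, R.Gfr j) + Real.pi ^ 8 * W / 2 ^ 11) * U ^ 2 ≤ 1 / 512) {P : SplitConsts} (hL : klEngL₄ P R β U ≤ L)
    (hZn : IsUnit (effPartitionFn ℂ (normalCovariance L M (uvSymbolCT L M β μ (klFlowFrameU L M β U μ (nScales β + 1)) (klScale klE0 (nScales β + 1))))
      (hubbardInteraction L M β U + counterQuadratic L M β (klFlowFrameU L M β U μ (nScales β + 1)))))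
    {Zb Zc Nmb Nsb Nmc Nsc : ℝ} (hZtU : 2 * (128 * (R.Gfr 0 + R.Gfr 1 + R.Gfr 2 + R.Gfr 3 + R.Gfr 4) * (1696963596321 + 925 * (10 ^ 14 * (1 + R.Gfr 3 + R.Gfr 4)))) * U ≤ 1)
    (hCU : 16 * (2 ^ 29 * (1 / 32) * (128 * (R.Gfr 0 + R.Gfr 1 + R.Gfr 2 + R.Gfr 3 + R.Gfr 4) * (1696963596321 + 925 * (10 ^ 14 * (1 + R.Gfr 3 + R.Gfr 4)))) ^ 3 * (1696963596321 +
      925 * (10 ^ 14 * (1 + R.Gfr 3 + R.Gfr 4))) + 2 ^ 38 * (128 * (R.Gfr 0 + R.Gfr 1 + R.Gfr 2 + R.Gfr 3 + R.Gfr 4) * (1696963596321 + 925 * (10 ^ 14 * (1 + R.Gfr 3 + R.Gfr 4)))) ^ 2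
      * Zb + 2 ^ 33 * (128 * (R.Gfr 0 + R.Gfr 1 + R.Gfr 2 + R.Gfr 3 + R.Gfr 4) * (1696963596321 + 925 * (10 ^ 14 * (1 + R.Gfr 3 + R.Gfr 4)))) * Zc + (klEngRsq R ^ 8 * (1696963596321 +
      925 * (10 ^ 14 * (1 + R.Gfr 3 + R.Gfr 4))) / 2 ^ 30 + (Nmb * klEngRsq R ^ 8 / 2 ^ 6 + Nsb / 2 ^ 217) * (1696963596321 + 925 * (10 ^ 14 * (1 + R.Gfr 3 + R.Gfr 4))) / 2 ^ 13 + (Nmc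
      * klEngRsq R ^ 8 / 2 ^ 6 + Nsc / 2 ^ 217) * (1696963596321 + 925 * (10 ^ 14 * (1 + R.Gfr 3 + R.Gfr 4))) / 2 ^ 13)) * U ≤ 1)
    {s : ℕ} (hs : 10 ≤ s)
    {Mmb : ℕ → ℝ} (hMmb : ∀ m ≤ 4, ∑ x : TorusSite 2 L, (1 + ((x 0).valMinAbs.natAbs : ℝ) + ((x 1).valMinAbs.natAbs : ℝ)) ^ m *
      ‖torusFourierInv (fun k => ((((fun k : TorusSite 2 L => klLocSelfEnergyRe L M β U μ (klFlowFrameU L M β U μ (nScales β + 1)) (nScales β + 1) k) k : ℝ)) : ℂ)) x‖ ≤ Mmb m)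
    {Msb : ℝ} (hMsb : ∑ x : TorusSite 2 L, (1 + ((x 0).valMinAbs.natAbs : ℝ) + ((x 1).valMinAbs.natAbs : ℝ)) ^ s *
      ‖torusFourierInv (fun k => ((((fun k : TorusSite 2 L => klLocSelfEnergyRe L M β U μ (klFlowFrameU L M β U μ (nScales β + 1)) (nScales β + 1) k) k : ℝ)) : ℂ)) x‖ ≤ Msb)
    {Mmc : ℕ → ℝ} (hMmc : ∀ m ≤ 4, ∑ x : TorusSite 2 L, (1 + ((x 0).valMinAbs.natAbs : ℝ) + ((x 1).valMinAbs.natAbs : ℝ)) ^ m *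
      ‖torusFourierInv (fun k => ((((fun k : TorusSite 2 L => (∑ s : Fin 2, ((klSelfEnergy L M β U μ (klFlowFrameU L M β U μ (nScales β + 1)) klE0 (nScales β + 1) (omega0 M, k) s).im -
          (klSelfEnergy L M β U μ (klFlowFrameU L M β U μ (nScales β + 1)) klE0 (nScales β + 1) ((omega0 M).rev, k) s).im)) / 4) k : ℝ)) : ℂ)) x‖ ≤ Mmc m)
    {Msc : ℝ} (hMsc : ∑ x : TorusSite 2 L, (1 + ((x 0).valMinAbs.natAbs : ℝ) + ((x 1).valMinAbs.natAbs : ℝ)) ^ s *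
      ‖torusFourierInv (fun k => ((((fun k : TorusSite 2 L => (∑ s : Fin 2, ((klSelfEnergy L M β U μ (klFlowFrameU L M β U μ (nScales β + 1)) klE0 (nScales β + 1) (omega0 M, k) s).im -
          (klSelfEnergy L M β U μ (klFlowFrameU L M β U μ (nScales β + 1)) klE0 (nScales β + 1) ((omega0 M).rev, k) s).im)) / 4) k : ℝ)) : ℂ)) x‖ ≤ Msc)
    (hZb : Nmb * (1696963596321 + 925 * (10 ^ 14 * (1 + R.Gfr 3 + R.Gfr 4))) ≤ Zb * U) (hZc : Nmc * (1696963596321 + 925 * (10 ^ 14 * (1 + R.Gfr 3 + R.Gfr 4))) * (4 : ℝ) ^ nScales β ≤ Zc * U ^ 2)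
    (hNmb : ∀ j ≤ 4, Mmb j ≤ Nmb * ((4 : ℝ) ^ nScales β) ^ j) (hNsb : Msb ≤ Nsb) (hNmc : ∀ j ≤ 4, Mmc j ≤ Nmc * ((4 : ℝ) ^ nScales β) ^ j) (hNsc : Msc ≤ Nsc) :
    ContDiff ℝ 4 (fun θ : ℝ => (symInterp L (fun k => klLocSelfEnergyRe L M β U μ (klFlowFrameU L M β U μ (nScales β + 1)) (nScales β + 1) k -
            (klFlowFrameU L M β U μ (nScales β + 1)).eval (latticeMomentum L k))).eval (klFermiPoint μ (klFlowFrameU L M β U μ (nScales β)) θ) -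
        (symInterp L (fun k => klLocSelfEnergyRe L M β U μ (klFlowFrameU L M β U μ (nScales β)) (nScales β + 1) k -
            (klFlowFrameU L M β U μ (nScales β)).eval (latticeMomentum L k))).eval (klFermiPoint μ (klFlowFrameU L M β U μ (nScales β)) θ)) ∧
    ∀ k ≤ 4, ∀ θ : ℝ, |iteratedDeriv k (fun θ : ℝ => (symInterp L (fun k => klLocSelfEnergyRe L M β U μ (klFlowFrameU L M β U μ (nScales β + 1)) (nScales β + 1) k -
            (klFlowFrameU L M β U μ (nScales β + 1)).eval (latticeMomentum L k))).eval (klFermiPoint μ (klFlowFrameU L M β U μ (nScales β)) θ) -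
        (symInterp L (fun k => klLocSelfEnergyRe L M β U μ (klFlowFrameU L M β U μ (nScales β)) (nScales β + 1) k -
            (klFlowFrameU L M β U μ (nScales β)).eval (latticeMomentum L k))).eval (klFermiPoint μ (klFlowFrameU L M β U μ (nScales β)) θ)) θ| ≤
      curveJetBar (fun k => if k = 0 then 0 else 1) (fun k => if k = 0 then 1 else 0) U k (nScales β + 1) := by
  have hl1 : (1 : ℝ) ≤ ((4 : ℝ) ^ nScales β) := one_le_pow₀ (by norm_num)
  have hl0 : (0 : ℝ) < ((4 : ℝ) ^ nScales β) := by positivity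
  -- the moments are nonnegative; so are the envelopes
  have hMmb0 : ∀ m ≤ 4, 0 ≤ Mmb m := fun m hm => le_trans (Finset.sum_nonneg fun x _ => by positivity) (hMmb m hm)
  have hMmc0 : ∀ m ≤ 4, 0 ≤ Mmc m := fun m hm => le_trans (Finset.sum_nonneg fun x _ => by positivity) (hMmc m hm)
  have hNmb0 : 0 ≤ Nmb := by have h := hNmb 0 (by norm_num); rw [pow_zero, mul_one] at h; exact (hMmb0 0 (by norm_num)).trans h
  have hNmc0 : 0 ≤ Nmc := by have h := hNmc 0 (by norm_num); rw [pow_zero, mul_one] at h; exact (hMmc0 0 (by norm_num)).trans h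
  -- the curve table of the old flow frame, sharp
  obtain ⟨hD1, hDc1, hDc2, hDc3, hDc4⟩ := flowCurve_table_sharp hR hU.le hU1 (nScales β)
  have hA₃0 : 0 ≤ (R.Gfr 3 * U ^ 2 * ((4 : ℝ) ^ (nScales β + 1) / 3)) := by have := hR 3; positivity
  have hA₄0 : 0 ≤ (R.Gfr 4 * U ^ 2 * ((16 : ℝ) ^ (nScales β + 1) / 15)) := by have := hR 4; positivity
  obtain ⟨n1, n2, n3, n4⟩ := klCurveD_sizes_nonneg hA₃0 hA₄0
  have hDc0 : ∀ i, 1 ≤ i → i ≤ 4 → 0 ≤ (fun i : ℕ => if i = 1 then klCurveD1 else if i = 2 then klCurveD2 else if i = 3 then klCurveD3 (R.Gfr 3 * U ^ 2 * ((4 : ℝ) ^ (nScales β + 1) / 3)) else klCurveD4 (R.Gfr 3 * U ^ 2 * ((4 : ℝ) ^ (nScales β + 1) / 3)) (R.Gfr 4 * U ^ 2 * ((16 : ℝ) ^ (nScales β + 1) / 15))) i := by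
    intro i hi1 hi4
    interval_cases i
    · exact n1
    · exact n2
    · exact n3
    · exact n4
  -- graded Bell rows of the moments themselves
  obtain ⟨pb0, pb1, pb2, pb3, pb4⟩ := bellRows_graded_le (f := Mmb) (Dc := (fun i : ℕ => if i = 1 then klCurveD1 else if i = 2 then klCurveD2 else if i = 3 then klCurveD3 (R.Gfr 3 * U ^ 2 * ((4 : ℝ) ^ (nScales β + 1) / 3)) else klCurveD4 (R.Gfr 3 * U ^ 2 * ((4 : ℝ) ^ (nScales β + 1) / 3)) (R.Gfr 4 * U ^ 2 * ((16 : ℝ) ^ (nScales β + 1) / 15)))) hl1 hNmb0 hD1 hMmb0 hNmb hDc0 hDc1 hDc2 hDc3 hDc4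
  obtain ⟨pc0, pc1, pc2, pc3, pc4⟩ := bellRows_graded_le (f := Mmc) (Dc := (fun i : ℕ => if i = 1 then klCurveD1 else if i = 2 then klCurveD2 else if i = 3 then klCurveD3 (R.Gfr 3 * U ^ 2 * ((4 : ℝ) ^ (nScales β + 1) / 3)) else klCurveD4 (R.Gfr 3 * U ^ 2 * ((4 : ℝ) ^ (nScales β + 1) / 3)) (R.Gfr 4 * U ^ 2 * ((16 : ℝ) ^ (nScales β + 1) / 15)))) hl1 hNmc0 hD1 hMmc0 hNmc hDc0 hDc1 hDc2 hDc3 hDc4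
  -- the two size rows
  have eP : ((231 : ℝ) ^ 4 + 6 * 231 ^ 2 * 700000 + 3 * 700000 ^ 2 + 4 * 231 * (10 ^ 14 * (1 + R.Gfr 3 + R.Gfr 4)) + (10 ^ 14 * (1 + R.Gfr 3 + R.Gfr 4))) = (1696963596321 + 925 * (10 ^ 14 * (1 + R.Gfr 3 + R.Gfr 4))) := by ring
  have sPb : ∀ j ≤ 4, Nmb * ((231 : ℝ) ^ 4 + 6 * 231 ^ 2 * 700000 + 3 * 700000 ^ 2 + 4 * 231 * (10 ^ 14 * (1 + R.Gfr 3 + R.Gfr 4)) + (10 ^ 14 * (1 + R.Gfr 3 + R.Gfr 4))) * ((4 : ℝ) ^ nScales β) ^ j ≤ Zb * U * ((4 : ℝ) ^ nScales β) ^ j := fun j _ =>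
    mul_le_mul_of_nonneg_right (by rw [eP]; exact hZb) (pow_nonneg hl0.le j)
  have sPc : ∀ j ≤ 4, Nmc * ((231 : ℝ) ^ 4 + 6 * 231 ^ 2 * 700000 + 3 * 700000 ^ 2 + 4 * 231 * (10 ^ 14 * (1 + R.Gfr 3 + R.Gfr 4)) + (10 ^ 14 * (1 + R.Gfr 3 + R.Gfr 4))) * ((4 : ℝ) ^ nScales β) ^ j ≤ Zc * U ^ 2 * ((4 : ℝ) ^ nScales β) ^ j / ((4 : ℝ) ^ nScales β) := fun j _ => by
    rw [le_div_iff₀ hl0]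
    calc Nmc * ((231 : ℝ) ^ 4 + 6 * 231 ^ 2 * 700000 + 3 * 700000 ^ 2 + 4 * 231 * (10 ^ 14 * (1 + R.Gfr 3 + R.Gfr 4)) + (10 ^ 14 * (1 + R.Gfr 3 + R.Gfr 4))) * ((4 : ℝ) ^ nScales β) ^ j * ((4 : ℝ) ^ nScales β) = (Nmc * ((231 : ℝ) ^ 4 + 6 * 231 ^ 2 * 700000 + 3 * 700000 ^ 2 + 4 * 231 * (10 ^ 14 * (1 + R.Gfr 3 + R.Gfr 4)) + (10 ^ 14 * (1 + R.Gfr 3 + R.Gfr 4))) * ((4 : ℝ) ^ nScales β)) * ((4 : ℝ) ^ nScales β) ^ j := by ring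
      _ ≤ (Zc * U ^ 2) * ((4 : ℝ) ^ nScales β) ^ j := mul_le_mul_of_nonneg_right (by rw [eP]; exact hZc) (pow_nonneg hl0.le j)
  exact lastResponse_bracket_flow_sharp_alias hR hc hcle hU hU1 hUle hβmin hβc hμ hK hGS hQS hR0 hPh hT hW hΞ hΘ hdoor hL hZn le_rfl hZtU hCU hs
    hMmb hMsb hMmc hMsc
    (PPb := fun j : ℕ => Nmb * ((231 : ℝ) ^ 4 + 6 * 231 ^ 2 * 700000 + 3 * 700000 ^ 2 + 4 * 231 * (10 ^ 14 * (1 + R.Gfr 3 + R.Gfr 4)) + (10 ^ 14 * (1 + R.Gfr 3 + R.Gfr 4))) * ((4 : ℝ) ^ nScales β) ^ j) pb0 pb1 pb2 pb3 pb4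
    (PPc := fun j : ℕ => Nmc * ((231 : ℝ) ^ 4 + 6 * 231 ^ 2 * 700000 + 3 * 700000 ^ 2 + 4 * 231 * (10 ^ 14 * (1 + R.Gfr 3 + R.Gfr 4)) + (10 ^ 14 * (1 + R.Gfr 3 + R.Gfr 4))) * ((4 : ℝ) ^ nScales β) ^ j) pc0 pc1 pc2 pc3 pc4
    sPb sPc hNmb hNsb hNmc hNsc

end FlowFinal

end Summit.HubbardSuperconductivity.HubbardSuperconductivity.Theorems.EngineV8

end
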